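import Literature.NumberTheory.CubicFields.CubicFieldDiscriminant14891
import HarnessLib

/-!
# The cubic field of discriminant `−14891` (LMFDB 3.1.14891.1), part 2: the primes above `p ≤ 11` are principal — PROVED

Sequel of `CubicFieldDiscriminant14891.lean` (same seat, same namespace `Literature.NumberTheory.CubicFields.CubicDisc14891`; §1–§2 there: the polynomial,
`d_F = −14891`, `𝓞_F = ℤ[θ]`, signature).  THEOREMS ONLY; every statement PROVED.  §3 (first half, this file): the `θ`-relation and
every prime of `𝓞_F` above `p ≤ 11` is principal (explicit generators / inert primes, Dedekind–Kummer); the primes above `13 ≤ p ≤ 31` and §4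
(★ `h_F = 1` by Minkowski, `not_two_dvd_classNumber`) are in the sequel `CubicFieldDiscriminant14891ClassNumber.lean`.  Written by the prover seat `bsd-line-att-p4` g38 (cell `bsd-f1-sign2`; g27's template) for the curve `[1,0,0,−122,−529]` of conductor
`14891 (prime)` on the doors-dead sub-cell (u1/u7) of crux C2 — the datum «`h(ℚ(β)) = 1`» of att-p3's / att-p5's class-group doors.

References: [LMFDB] number field 3.1.14891.1 (class number 1); [Marcus2018] Ch. 3 Thm. 27, Ch. 5 Thm. 37 and Cor. 2.
-/

noncomputable section

open Polynomial NumberField NumberField.InfinitePlace Ideal Module Real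
open Literature.NumberTheory.NumberFields
open Literature.NumberTheory.NumberFields.MonicCubic

namespace Literature.NumberTheory.CubicFields.CubicDisc14891

section NumberField

variable {F : Type*} [Field F] [NumberField F] {α : F}

/-! ## §3 The primes of norm `≤ 34` are principal -/

/-- The cubic relation `θ³ + aθ² + bθ + c = 0` in `𝓞_F`, numerals pushed (private helper). [folklore] -/
private theorem theta_rel (hα : aeval α (poly (-7) (-9) (-8)) = 0) :
    thetaInt hα ^ 3 + (-7) * thetaInt hα ^ 2 + (-9) * thetaInt hα + (-8) = 0 := by
  have h := thetaInt_rel hα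
  push_cast at h
  linear_combination h

/-- `(2, θ + 0) = (-10 - 7 * θ + θ ^ 2)` (an element of norm `±2`). [cite: Marcus2018, Ch. 3, Thm. 27] -/
theorem span_2_lin0_eq (hα : aeval α (poly (-7) (-9) (-8)) = 0) :
    span {(2 : 𝓞 F), thetaInt hα} = span {-10 - 7 * thetaInt hα + thetaInt hα ^ 2} := by
  have hrel := theta_rel hα
  apply le_antisymm
  · rw [span_le]
    rintro x hx
    rcases hx with rfl | hx
    · exact mem_span_singleton'.mpr ⟨-1 - thetaInt hα - thetaInt hα ^ 2, by linear_combination (-1 - thetaInt hα) * hrel⟩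
    · rw [Set.mem_singleton_iff.mp hx]
      exact mem_span_singleton'.mpr ⟨-4 - 5 * thetaInt hα - 4 * thetaInt hα ^ 2, by linear_combination (-5 - 4 * thetaInt hα) * hrel⟩
  · rw [span_singleton_le_iff_mem, mem_span_pair]
    exact ⟨15 + 22 * thetaInt hα + 21 * thetaInt hα ^ 2, -6 - 6 * thetaInt hα - 5 * thetaInt hα ^ 2, by linear_combination (-5) * hrel⟩

/-- `(2, θ² + 1θ + 1) = (-1 - θ - θ ^ 2)` (an element of norm `4`). [cite: Marcus2018, Ch. 3, Thm. 27] -/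
theorem span_2_quad_eq (hα : aeval α (poly (-7) (-9) (-8)) = 0) :
    span {(2 : 𝓞 F), thetaInt hα ^ 2 + thetaInt hα + 1} = span {-1 - thetaInt hα - thetaInt hα ^ 2} := by
  have hrel := theta_rel hα
  apply le_antisymm
  · rw [span_le]
    rintro x hx
    rcases hx with rfl | hx
    · exact mem_span_singleton'.mpr ⟨-10 - 7 * thetaInt hα + thetaInt hα ^ 2, by linear_combination (-1 - thetaInt hα) * hrel⟩
    · rw [Set.mem_singleton_iff.mp hx]
      exact mem_span_singleton'.mpr ⟨-1, by linear_combination ((0 : 𝓞 F)) * hrel⟩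
  · rw [span_singleton_le_iff_mem, mem_span_pair]
    exact ⟨218 + 272 * thetaInt hα + 224 * thetaInt hα ^ 2, -5 - 6 * thetaInt hα - 6 * thetaInt hα ^ 2, by linear_combination (-54 - 6 * thetaInt hα) * hrel⟩

/-- **Every prime of `𝓞_F` above `2` is principal** (Dedekind–Kummer with `polyMod_2` and the generators above).
[cite: Marcus2018, Ch. 3, Thm. 27] [cite: LMFDB, number field 3.1.14891.1 (class number 1)] -/
theorem isPrincipal_of_mem_primesOver_2 (h3 : finrank ℚ F = 3) (hα : aeval α (poly (-7) (-9) (-8)) = 0) {P : Ideal (𝓞 F)}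
    (hP : P ∈ primesOver (span {((2 : ℕ) : ℤ)}) (𝓞 F)) : Submodule.IsPrincipal P := by
  haveI : Fact (Nat.Prime 2) := ⟨by norm_num⟩
  obtain ⟨Qb, hirr, hmon, hdvd, -, hspan⟩ :=
    exists_factor_of_mem_primesOver irreducible_polyQ hα h3 isUnit_of_disc_eq_sq_mul (by norm_num : Nat.Prime 2) hP
  rw [polyMod_2] at hdvd
  rcases hirr.prime.dvd_or_dvd hdvd with h | h
  · have hQb : Qb = X := eq_of_monic_of_associated hmon monic_X (hirr.associated_of_dvd irreducible_X h)
    have hPeq := hspan X (by rw [hQb, Polynomial.map_X])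
    rw [aeval_X, Nat.cast_ofNat, span_2_lin0_eq hα] at hPeq
    exact ⟨⟨-10 - 7 * thetaInt hα + thetaInt hα ^ 2, by rw [hPeq, Ideal.submodule_span_eq]⟩⟩
  · have hQb : Qb = X ^ 2 + X + 1 :=
      eq_of_monic_of_associated hmon (by monicity!) (hirr.associated_of_dvd CubicDisc307.irreducible_quad_two h)
    have hPeq := hspan (X ^ 2 + X + 1) (by rw [hQb]; simp)
    rw [show aeval (thetaInt hα) (X ^ 2 + X + 1 : ℤ[X]) = thetaInt hα ^ 2 + thetaInt hα + 1 by
        simp only [map_add, map_pow, aeval_X, map_one], Nat.cast_ofNat, span_2_quad_eq hα] at hPeq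
    exact ⟨⟨-1 - thetaInt hα - thetaInt hα ^ 2, by rw [hPeq, Ideal.submodule_span_eq]⟩⟩

/-- **Every prime of `𝓞_F` above `3` is principal**: `3` is inert, the prime is `(3)`. [cite: Marcus2018, Ch. 3, Thm. 27] -/
theorem isPrincipal_of_mem_primesOver_3 (h3 : finrank ℚ F = 3) (hα : aeval α (poly (-7) (-9) (-8)) = 0) {P : Ideal (𝓞 F)}
    (hP : P ∈ primesOver (span {((3 : ℕ) : ℤ)}) (𝓞 F)) : Submodule.IsPrincipal P := by
  have hPeq := eq_span_of_no_root irreducible_polyQ hα h3 isUnit_of_disc_eq_sq_mul (by norm_num : Nat.Prime 3) hP no_root_3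
  exact ⟨⟨((3 : ℕ) : 𝓞 F), by rw [hPeq, Ideal.submodule_span_eq]⟩⟩

/-- `f` has no root modulo `5`: `5` is inert. [cite: Marcus2018, Ch. 3, Thm. 27] -/
theorem no_root_5' : ∀ r : ZMod 5, r ^ 3 + ((-7 : ℤ) : ZMod 5) * r ^ 2 + ((-9 : ℤ) : ZMod 5) * r + ((-8 : ℤ) : ZMod 5) ≠ 0 := by
  decide

/-- **Every prime of `𝓞_F` above `5` is principal**: `5` is inert, the prime is `(5)`. [cite: Marcus2018, Ch. 3, Thm. 27] -/
theorem isPrincipal_of_mem_primesOver_5 (h3 : finrank ℚ F = 3) (hα : aeval α (poly (-7) (-9) (-8)) = 0) {P : Ideal (𝓞 F)}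
    (hP : P ∈ primesOver (span {((5 : ℕ) : ℤ)}) (𝓞 F)) : Submodule.IsPrincipal P := by
  have hPeq := eq_span_of_no_root irreducible_polyQ hα h3 isUnit_of_disc_eq_sq_mul (by norm_num : Nat.Prime 5) hP no_root_5'
  exact ⟨⟨((5 : ℕ) : 𝓞 F), by rw [hPeq, Ideal.submodule_span_eq]⟩⟩

/-- `(7, θ + 1) = (-1 - θ)` (an element of norm `±7`). [cite: Marcus2018, Ch. 3, Thm. 27] -/
theorem span_7_lin1_eq (hα : aeval α (poly (-7) (-9) (-8)) = 0) :
    span {(7 : 𝓞 F), thetaInt hα + 1} = span {-1 - thetaInt hα} := by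
  have hrel := theta_rel hα
  apply le_antisymm
  · rw [span_le]
    rintro x hx
    rcases hx with rfl | hx
    · exact mem_span_singleton'.mpr ⟨1 + 8 * thetaInt hα - thetaInt hα ^ 2, by linear_combination (1) * hrel⟩
    · rw [Set.mem_singleton_iff.mp hx]
      exact mem_span_singleton'.mpr ⟨-1, by linear_combination ((0 : 𝓞 F)) * hrel⟩
  · rw [span_singleton_le_iff_mem, mem_span_pair]
    exact ⟨3 + 4 * thetaInt hα + 3 * thetaInt hα ^ 2, -6 - 5 * thetaInt hα - 2 * thetaInt hα ^ 2, by linear_combination (-2) * hrel⟩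

/-- **Every prime of `𝓞_F` above `7` with `7^f ≤ 34` is principal** (Dedekind–Kummer with `polyMod_7` and the generators above).
[cite: Marcus2018, Ch. 3, Thm. 27] [cite: LMFDB, number field 3.1.14891.1 (class number 1)] -/
theorem isPrincipal_of_mem_primesOver_7 (h3 : finrank ℚ F = 3) (hα : aeval α (poly (-7) (-9) (-8)) = 0) {P : Ideal (𝓞 F)}
    (hP : P ∈ primesOver (span {((7 : ℕ) : ℤ)}) (𝓞 F))
    (hle : 7 ^ P.inertiaDeg ℤ ≤ 34) : Submodule.IsPrincipal P := by
  haveI : Fact (Nat.Prime 7) := ⟨by norm_num⟩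
  obtain ⟨Qb, hirr, hmon, hdvd, hdeg, hspan⟩ :=
    exists_factor_of_mem_primesOver irreducible_polyQ hα h3 isUnit_of_disc_eq_sq_mul (by norm_num : Nat.Prime 7) hP
  rw [polyMod_7] at hdvd
  rcases hirr.prime.dvd_or_dvd hdvd with h | h
  · have hirr1 : Irreducible (X + 1 : (ZMod 7)[X]) := by
      rw [show (X + 1 : (ZMod 7)[X]) = X - C (-1) by rw [map_neg, map_one, sub_neg_eq_add]]
      exact irreducible_X_sub_C _
    have hQb : Qb = X + 1 := eq_of_monic_of_associated hmon (by monicity!) (hirr.associated_of_dvd hirr1 h)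
    have hPeq := hspan (X + 1) (by rw [hQb]; simp)
    rw [show aeval (thetaInt hα) (X + 1 : ℤ[X]) = thetaInt hα + 1 by
        simp only [map_add, aeval_X, map_one], Nat.cast_ofNat, span_7_lin1_eq hα] at hPeq
    exact ⟨⟨-1 - thetaInt hα, by rw [hPeq, Ideal.submodule_span_eq]⟩⟩
  · have hQb : Qb = X ^ 2 + 6 * X + 6 :=
      eq_of_monic_of_associated hmon (by monicity!) (hirr.associated_of_dvd irreducible_quad_7 h)
    exfalso
    have hd2 : (X ^ 2 + 6 * X + 6 : (ZMod 7)[X]).natDegree = 2 := by compute_degree!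
    rw [hdeg, hQb, hd2] at hle
    norm_num at hle

/-- `f` has no root modulo `11`: `11` is inert. [cite: Marcus2018, Ch. 3, Thm. 27] -/
theorem no_root_11' : ∀ r : ZMod 11, r ^ 3 + ((-7 : ℤ) : ZMod 11) * r ^ 2 + ((-9 : ℤ) : ZMod 11) * r + ((-8 : ℤ) : ZMod 11) ≠ 0 := by
  decide

/-- **Every prime of `𝓞_F` above `11` is principal**: `11` is inert, the prime is `(11)`. [cite: Marcus2018, Ch. 3, Thm. 27] -/
theorem isPrincipal_of_mem_primesOver_11 (h3 : finrank ℚ F = 3) (hα : aeval α (poly (-7) (-9) (-8)) = 0) {P : Ideal (𝓞 F)}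
    (hP : P ∈ primesOver (span {((11 : ℕ) : ℤ)}) (𝓞 F)) : Submodule.IsPrincipal P := by
  have hPeq := eq_span_of_no_root irreducible_polyQ hα h3 isUnit_of_disc_eq_sq_mul (by norm_num : Nat.Prime 11) hP no_root_11'
  exact ⟨⟨((11 : ℕ) : 𝓞 F), by rw [hPeq, Ideal.submodule_span_eq]⟩⟩

end NumberField

end Literature.NumberTheory.CubicFields.CubicDisc14891

end
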